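import Literature.AlgebraicGeometry.Motives.HodgeStructureLefschetzGroupIsotypicBlock
import Literature.AlgebraicGeometry.Motives.HodgeStructureLefschetzGroupFiniteDirectSumPoints
import HarnessLib

/-!
# MILNE'S PROP. 1.5 ON `K`-POINTS, INTERNALLY: for every field `K ⊇ ℚ`, `S(H)(K) ≃* Π_k S(W_k)(K)` along a Hom-orthogonal
# internal direct sum of sub-Hodge structures of a polarized `ℚ`-Hodge structure, over the canonical blocks, and
# `S(H)(K) ≃* Π_k S(T_k)(K)` over the representatives `T_k` of the isotypy classes; `S(H)(K)` transports along Hodge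
# isomorphisms for ANY polarizations (Milne 1999 §1 Prop. 1.5 and Remark 1.6)

[topic AlgebraicGeometry/Motives]

Layer `Literature/AlgebraicGeometry/Motives`, lane `lit-hodgefound` (Track 2 foundations library; prover seat
`lit-hodgefound-p02`, generation 52, self-proposed row g52-#9). THEOREMS ONLY: no definition, no named fact (net debt `0`),
no instance, no notation.  The `K`-points companion of g52-#4 ∕ #6 (`S(H)(ℚ) ≃* Π_k S(W_k)(ℚ)`, `S(H)(ℚ) ≃* Π_k S(T_k)(ℚ)`):
Milne's `S(A)` is an algebraic group, `S(A)(R) = {γ ∈ C(A) ⊗ R | γ†γ = 1}`, and p34's `Polarization.lefschetzGroupBaseChange K`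
are its `K`-points for fields `K ⊇ ℚ`.  Joins BY NAME (nothing restated): p34's `K`-points transport
`Polarization.lefschetzGroupBaseChangeComapEquivMulEquiv : S(e^* H)(K) ≃* S(H)(K)` (`Motives/HodgeStructureLefschetzGroupTransport`),
its `K`-points polarization-independence `Polarization.lefschetzGroupBaseChange_eq_of_polarization` (`Motives/HodgeStructureLefschetzGroupPoints`;
`HodgeTensorFacts` discharged by `hodgeTensorFacts_holds`), its EXTERNAL Prop. 1.5 on `K`-points
`Polarization.lefschetzGroupBaseChangePiMulEquiv : Π_j S(H_j)(K) ≃* S(⊕_j H_j)(K)` and diagonal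
`Polarization.lefschetzGroupBaseChangePiConstMulEquiv : S(H₀)(K) ≃* S(H₀^{⊕ι})(K)` (`Motives/HodgeStructureLefschetzGroupFiniteDirectSumPoints`),
g52-#5's `eq_comapEquiv_of_hom_bijective`, `bijective_piDesc_subtypeHom_comp_toLinearMap`, the isotypic blocks of a labelled
decomposition (`isInternal_iSup'_fiber`, `hom_iSup'_fiber_eq_zero`, `isInternal_comapSubtype_iSup'_fiber`,
`exists_hom_comapSubtype_bijective`), g51's canonical blocks (`Polarization.isInternal_minimal_stable`,
`Polarization.hom_eq_zero_of_minimal_stable_of_ne`, `Polarization.finite_setOf_minimal_stable`) and g52-#1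
(`existsUnique_iSup'_fiber_eq_of_minimal_stable`, `exists_hom_bijective_iff_eq_of_minimal_stable`).  The internal direct sum
`V = ⊕_k W_k` is read through the Hodge isomorphism `⊕_k W_k ⥲ H` (`bijective_piDesc_subtypeHom_toLinearMap`, §1).

## The source, verbatim

J. S. Milne, *Lefschetz classes on abelian varieties*, Duke Math. J. 96 (1999) 639–675 [Milne1999LefschetzClasses] (held
`paper:doi-10-1215-s0012-7094-99-09620-5`), §1 p. 644 L16–L21: "we define `S(A)` to be the algebraic subgroup of `GL(V(A))` such
that, for all commutative `k`-algebras `R`, `S(A)(R) = {γ ∈ C(A) ⊗_k R | γ†γ = 1}`. […] Clearly `S(A)` depends only on the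
isogeny class of `A` (up to a unique isomorphism)."; L24–L28: "**Proposition 1.5.** Let `A₁, …, A_s` be a set of representatives
for the simple isogeny factors of `A` […]. Any such isogeny induces an isomorphism `S(A₁) × ⋯ × S(A_s) → S(A)`, which is
independent of the choice of the isogeny."; L30–L34: "**Remark 1.6.** If `X → H*(X)` is a Weil cohomology theory with coefficient
field `k`, and `k'` is a field containing `k`, then `X → H*(X) ⊗_k k'` is a Weil cohomology theory with coefficient field `k'`. If
`C'(A)` and `S'(A)` denote the objects defined relative to the second theory, then there are canonical isomorphisms
`C'(A) ≅ C(A) ⊗_k k'`, `S'(A) ≅ S(A)_{/k'}`."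

## Dictionary and what is proved (namespace `Literature.AlgebraicGeometry.Motives.HodgeStructure`)

`S(H, Q)(K) = Q.lefschetzGroupBaseChange K ≤ GL(K ⊗_ℚ V)` (the `γ` commuting with `E_φ ⊗ K` and preserving `Q_K`), `ψ|_S =
ψ.restrict S`, `⊕_k W_k = HodgeStructure.pi (fun k ↦ (W k).toHodgeStructure)`.  p34's external lemmas have small index types
(`ι : Type`); arbitrary finite index types are reached by re-indexing along `Fintype.equivFin` (a private re-indexing lemma for
internal direct sums; the product of groups is re-indexed by `Equiv.piCongrLeft'` made multiplicative inside the proof).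

* §1 `bijective_piDesc_subtypeHom_toLinearMap` (`⊕_k W_k ⥲ H` for an internal direct sum),
  `Polarization.lefschetzGroupBaseChange_eq_of_hodgeStructure_eq`, **`Polarization.exists_lefschetzGroupBaseChange_mulEquiv_of_hom_bijective`**
  (a Hodge isomorphism `g : H₁ ⥲ H₂` induces `S(H₁, Q₁)(K) ≃* S(H₂, Q₂)(K)`, `γ ↦ g_K γ g_K⁻¹`, for ANY polarizations).
* §2 **`Polarization.nonempty_lefschetzGroupBaseChange_mulEquiv_pi_of_hom_orthogonal`** (PROP. 1.5 on `K`-points along a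
  Hom-orthogonal internal direct sum: `S(H, ψ)(K) ≃* Π_k S(W_k, ψ|_{W_k})(K)`), `…_of_forall_stable`,
  **`Polarization.nonempty_lefschetzGroupBaseChange_mulEquiv_pi_minimal_stable`** (over the canonical blocks).
* §3 **`Polarization.nonempty_lefschetzGroupBaseChange_mulEquiv_of_isInternal_of_forall_bijective`** (`S(⊕ᵢ Tᵢ ≅ H₀)(K) ≃* S(H₀)(K)`),
  `Polarization.nonempty_lefschetzGroupBaseChange_restrict_iSup'_fiber_mulEquiv` (`S(W_k)(K) ≃* S(T_k)(K)` per isotypic block),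
  **`Polarization.nonempty_lefschetzGroupBaseChange_mulEquiv_pi_of_labelling`** (PROP. 1.5 on `K`-points over the representatives:
  `S(H)(K) ≃* Π_k S(T_k)(K)`), **`Polarization.nonempty_lefschetzGroupBaseChange_restrict_mulEquiv_of_minimal_stable`**
  (`S(S)(K) ≃* S(U)(K)` for a canonical block `S ⊇ U` irreducible).
-/

noncomputable section

open scoped TensorProduct

namespace Literature.AlgebraicGeometry.Motives

namespace HodgeStructure

universe u uK

variable (K : Type uK) [Field K] [Algebra ℚ K] {n : ℤ}

/-- Re-indexing an internal direct sum along an equivalence of index types. [folklore] -/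
private theorem isInternal_comp_equiv'' {V' : Type u} [AddCommGroup V'] [Module ℚ V'] {ι ι' : Type*} [DecidableEq ι]
    [DecidableEq ι'] {A : ι → Submodule ℚ V'} (hA : DirectSum.IsInternal A) (e : ι' ≃ ι) :
    DirectSum.IsInternal fun j => A (e j) := by
  refine (DirectSum.isInternal_submodule_iff_iSupIndep_and_iSup_eq_top _).2 ⟨?_, ?_⟩
  · exact hA.submodule_iSupIndep.comp e.injective
  · rw [e.iSup_comp (g := A)]
    exact hA.submodule_iSup_eq_top

/-! ## §1 `⊕_k W_k ⥲ H`; transport of `S(K)` along a Hodge isomorphism, any polarizations -/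

section Transport

variable {V W : Type u} [AddCommGroup V] [Module ℚ V] [Module.Finite ℚ V] [AddCommGroup W] [Module ℚ W]
  {H₁ : HodgeStructure V n} {H₂ : HodgeStructure W n}

omit K in
/-- **`(x_k)_k ↦ Σ_k x_k` is a BIJECTIVE morphism of Hodge structures `⊕_k W_k → H`** for an internal direct sum `V = ⊕_k W_k` of
sub-Hodge structures (surjective onto `Σ_k W_k = V`; injective by the dimension count `Σ_k dim W_k = dim V`).
[cite: DeligneHodgeII1971, 2.1.15] [cite: VoisinHodgeI2002, §7.3.1 Lemma 7.26] -/
theorem bijective_piDesc_subtypeHom_toLinearMap {H : HodgeStructure V n} {κ : Type*} [Fintype κ] [DecidableEq κ]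
    (W : κ → SubHodgeStructure H) (hW : DirectSum.IsInternal fun k => (W k).toSubmodule) :
    Function.Bijective (Hom.piDesc fun k => (W k).subtypeHom).toLinearMap := by
  have hsurj : Function.Surjective (Hom.piDesc fun k => (W k).subtypeHom).toLinearMap := by
    rw [← LinearMap.range_eq_top, Hom.range_piDesc, ← hW.submodule_iSup_eq_top]
    exact iSup_congr fun k => by rw [SubHodgeStructure.subtypeHom_toLinearMap, Submodule.range_subtype]
  haveI : ∀ k, Module.Free ℚ (W k).toSubmodule := fun k => Module.Free.of_divisionRing ℚ _
  have hdim : Module.finrank ℚ (Π k, (W k).toSubmodule) = Module.finrank ℚ V := by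
    rw [Module.finrank_pi_fintype, Module.finrank_eq_card_basis
      (hW.collectedBasis fun k => Module.finBasis ℚ (W k).toSubmodule), Fintype.card_sigma]
    exact Finset.sum_congr rfl fun k _ => (Fintype.card_fin _).symm
  exact ⟨(LinearMap.injective_iff_surjective_of_finrank_eq_finrank hdim).2 hsurj, hsurj⟩

/-- Two (propositionally) equal Hodge structures on one carrier have the same `S(K)` for ANY two polarizations (p34's
`K`-points polarization-independence, its `HodgeTensorFacts` hypothesis discharged by `hodgeTensorFacts_holds`).
[cite: Milne1999LefschetzClasses, §1 p. 644 L16–L20] [cite: Lange2023AbelianVarietiesComplex, §7.2.4 Exercise (4) (a)] -/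
theorem Polarization.lefschetzGroupBaseChange_eq_of_hodgeStructure_eq {H H' : HodgeStructure V n} (h : H = H')
    (Q : Polarization H) (Q' : Polarization H') : Q.lefschetzGroupBaseChange K = Q'.lefschetzGroupBaseChange K := by
  subst h
  haveI : HodgeTensorFacts.{u, u} := hodgeTensorFacts_holds
  exact Polarization.lefschetzGroupBaseChange_eq_of_polarization K Q Q'

/-- **«`S(A)` depends only on the isogeny class of `A` (up to a unique isomorphism)», on `K`-points**: a bijective morphism of
Hodge structures `g : H₁ ⥲ H₂` induces `S(H₁, Q₁)(K) ≃* S(H₂, Q₂)(K)`, `γ ↦ g_K ∘ γ ∘ g_K⁻¹` (`g_K = g ⊗ K`), for ANY polarizations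
`Q₁` of `H₁`, `Q₂` of `H₂` (`H₁ = g^* H₂`, p34's transport `S(g^* H₂, g^* Q₂)(K) ≃* S(H₂, Q₂)(K)`, and independence of the
polarization). [cite: Milne1999LefschetzClasses, §1 p. 644 L16–L21 and Remark 1.6] -/
theorem Polarization.exists_lefschetzGroupBaseChange_mulEquiv_of_hom_bijective (g : Hom H₁ H₂)
    (hg : Function.Bijective g.toLinearMap) (Q₁ : Polarization H₁) (Q₂ : Polarization H₂) :
    ∃ e : Q₁.lefschetzGroupBaseChange K ≃* Q₂.lefschetzGroupBaseChange K,
      ∀ (γ : Q₁.lefschetzGroupBaseChange K) (x : K ⊗[ℚ] V),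
        ((e γ : Q₂.lefschetzGroupBaseChange K) : (K ⊗[ℚ] W) ≃ₗ[K] (K ⊗[ℚ] W)) (g.toLinearMap.baseChange K x) =
          g.toLinearMap.baseChange K ((γ : (K ⊗[ℚ] V) ≃ₗ[K] (K ⊗[ℚ] V)) x) := by
  have heq := Polarization.lefschetzGroupBaseChange_eq_of_hodgeStructure_eq K (eq_comapEquiv_of_hom_bijective g hg) Q₁
    (Q₂.comapEquiv (LinearEquiv.ofBijective g.toLinearMap hg))
  refine ⟨(MulEquiv.subgroupCongr heq).trans
    (Q₂.lefschetzGroupBaseChangeComapEquivMulEquiv K (LinearEquiv.ofBijective g.toLinearMap hg)), fun γ x => ?_⟩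
  have hx : g.toLinearMap.baseChange K x = (LinearEquiv.ofBijective g.toLinearMap hg).baseChange ℚ K V W x := rfl
  rw [MulEquiv.trans_apply, Polarization.coe_lefschetzGroupBaseChangeComapEquivMulEquiv_apply, hx,
    LinearEquiv.symm_apply_apply]
  rfl

end Transport

/-! ## §2 Prop. 1.5 on `K`-points along a Hom-orthogonal internal direct sum, and over the canonical blocks -/

section Blocks

variable {V : Type u} [AddCommGroup V] [Module ℚ V] [Module.Finite ℚ V] {H : HodgeStructure V n}

/-- Prop. 1.5 on `K`-points for a Hom-orthogonal internal direct sum with a SMALL index type (`κ : Type`): transport along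
`⊕_k W_k ⥲ H` (§1), then p34's external `Π_k S(W_k)(K) ≃* S(⊕_k W_k)(K)`. [cite: Milne1999LefschetzClasses, §1 Prop. 1.5 (p. 644) and Remark 1.6] -/
theorem Polarization.nonempty_lefschetzGroupBaseChange_mulEquiv_pi_of_hom_orthogonal_small {κ : Type} [Fintype κ]
    [DecidableEq κ] (W : κ → SubHodgeStructure H) (hW : DirectSum.IsInternal fun k => (W k).toSubmodule)
    (horth : ∀ k l, k ≠ l → ∀ f : Hom (W k).toHodgeStructure (W l).toHodgeStructure, f = 0) (ψ : Polarization H) :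
    Nonempty (ψ.lefschetzGroupBaseChange K ≃* Π k, (ψ.restrict (W k)).lefschetzGroupBaseChange K) := by
  obtain ⟨e, -⟩ := Polarization.exists_lefschetzGroupBaseChange_mulEquiv_of_hom_bijective K _
    (bijective_piDesc_subtypeHom_toLinearMap W hW) (Polarization.pi fun k => ψ.restrict (W k)) ψ
  have h0 : ∀ i j, i ≠ j → ∀ φ : Hom (W j).toHodgeStructure (W i).toHodgeStructure, φ.toLinearMap = 0 :=
    fun i j hij φ => by rw [horth j i (Ne.symm hij) φ, Hom.zero_toLinearMap]
  exact ⟨e.symm.trans (Polarization.lefschetzGroupBaseChangePiMulEquiv K (fun k => ψ.restrict (W k)) h0).symm⟩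

/-- **MILNE'S PROP. 1.5 ON `K`-POINTS, INTERNALLY: `S(H, ψ)(K) ≃* Π_k S(W_k, ψ|_{W_k})(K)`** for every field `K ⊇ ℚ` and every
Hom-orthogonal internal direct sum `V = ⊕_k W_k` of sub-Hodge structures of a polarized `ℚ`-Hodge structure («any such isogeny
induces an isomorphism `S(A₁) × ⋯ × S(A_s) → S(A)`» of algebraic groups, read on `K`-points; Remark 1.6 `S'(A) ≅ S(A)_{/k'}`).
[cite: Milne1999LefschetzClasses, §1 Prop. 1.5 (p. 644) and Remark 1.6] [cite: Lange2023AbelianVarietiesComplex, §7.2.4 Exercise (4)] -/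
theorem Polarization.nonempty_lefschetzGroupBaseChange_mulEquiv_pi_of_hom_orthogonal {κ : Type*} [Fintype κ] [DecidableEq κ]
    (W : κ → SubHodgeStructure H) (hW : DirectSum.IsInternal fun k => (W k).toSubmodule)
    (horth : ∀ k l, k ≠ l → ∀ f : Hom (W k).toHodgeStructure (W l).toHodgeStructure, f = 0) (ψ : Polarization H) :
    Nonempty (ψ.lefschetzGroupBaseChange K ≃* Π k, (ψ.restrict (W k)).lefschetzGroupBaseChange K) := by
  let eκ := Fintype.equivFin κ
  obtain ⟨e⟩ := ψ.nonempty_lefschetzGroupBaseChange_mulEquiv_pi_of_hom_orthogonal_small K (fun j => W (eκ.symm j))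
    (isInternal_comp_equiv'' hW eκ.symm) fun j j' hjj' f => horth _ _ (fun h => hjj' (eκ.symm.injective h)) f
  -- re-indexing the product of groups along `eκ`
  let π : (Π k, (ψ.restrict (W k)).lefschetzGroupBaseChange K) ≃*
      Π j, (ψ.restrict (W (eκ.symm j))).lefschetzGroupBaseChange K :=
    { Equiv.piCongrLeft' (fun k => ↥((ψ.restrict (W k)).lefschetzGroupBaseChange K)) eκ with map_mul' := fun _ _ => rfl }
  exact ⟨e.trans π.symm⟩

/-- **`S(H)(K) ≃* Π_k S(W_k)(K)` along an internal direct sum into `E_φ`-STABLE sub-Hodge structures** (stable blocks are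
Hom-orthogonal, g52-#3). [cite: Milne1999LefschetzClasses, §1 Prop. 1.5 (p. 644) and Remark 1.6] -/
theorem Polarization.nonempty_lefschetzGroupBaseChange_mulEquiv_pi_of_forall_stable {κ : Type*} [Fintype κ] [DecidableEq κ]
    (W : κ → SubHodgeStructure H) (hW : DirectSum.IsInternal fun k => (W k).toSubmodule)
    (hst : ∀ k, ∀ a ∈ H.endAlg, ∀ v ∈ (W k).toSubmodule, a v ∈ (W k).toSubmodule) (ψ : Polarization H) :
    Nonempty (ψ.lefschetzGroupBaseChange K ≃* Π k, (ψ.restrict (W k)).lefschetzGroupBaseChange K) :=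
  ψ.nonempty_lefschetzGroupBaseChange_mulEquiv_pi_of_hom_orthogonal K W hW fun _ _ hkl f =>
    hom_eq_zero_of_forall_stable W hW hst hkl f

open Classical in
/-- **`S(H)(K) ≃* Π_i S(S_i)(K)` over the CANONICAL blocks** — the minimal `E_φ`-stable sub-Hodge structures `S_i` of a polarized
`ℚ`-Hodge structure (`V = ⊕_i S_i`, Hom-orthogonal, g51), each with its restricted polarization.
[cite: Milne1999LefschetzClasses, §1 Prop. 1.5 (p. 644) and Remark 1.6] [cite: Lange2023AbelianVarietiesComplex, §2.4.4 Cor. 2.4.26 (p. 124)] -/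
theorem Polarization.nonempty_lefschetzGroupBaseChange_mulEquiv_pi_minimal_stable (ψ : Polarization H) :
    Nonempty (ψ.lefschetzGroupBaseChange K ≃*
      Π S : {S : SubHodgeStructure H // (∀ a ∈ H.endAlg, ∀ v ∈ S.toSubmodule, a v ∈ S.toSubmodule) ∧ S.toSubmodule ≠ ⊥ ∧
        ∀ S' : SubHodgeStructure H, (∀ a ∈ H.endAlg, ∀ v ∈ S'.toSubmodule, a v ∈ S'.toSubmodule) →
          S'.toSubmodule ≤ S.toSubmodule → S'.toSubmodule = ⊥ ∨ S'.toSubmodule = S.toSubmodule},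
        (ψ.restrict (S : SubHodgeStructure H)).lefschetzGroupBaseChange K) := by
  haveI : Fintype {S : SubHodgeStructure H // (∀ a ∈ H.endAlg, ∀ v ∈ S.toSubmodule, a v ∈ S.toSubmodule) ∧ S.toSubmodule ≠ ⊥ ∧
      ∀ S' : SubHodgeStructure H, (∀ a ∈ H.endAlg, ∀ v ∈ S'.toSubmodule, a v ∈ S'.toSubmodule) →
        S'.toSubmodule ≤ S.toSubmodule → S'.toSubmodule = ⊥ ∨ S'.toSubmodule = S.toSubmodule} :=
    ψ.finite_setOf_minimal_stable.fintype
  exact ψ.nonempty_lefschetzGroupBaseChange_mulEquiv_pi_of_hom_orthogonal K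
    (Subtype.val : {S : SubHodgeStructure H // (∀ a ∈ H.endAlg, ∀ v ∈ S.toSubmodule, a v ∈ S.toSubmodule) ∧ S.toSubmodule ≠ ⊥ ∧
      ∀ S' : SubHodgeStructure H, (∀ a ∈ H.endAlg, ∀ v ∈ S'.toSubmodule, a v ∈ S'.toSubmodule) →
        S'.toSubmodule ≤ S.toSubmodule → S'.toSubmodule = ⊥ ∨ S'.toSubmodule = S.toSubmodule} → SubHodgeStructure H)
    ψ.isInternal_minimal_stable
    fun S S' hne f => ψ.hom_eq_zero_of_minimal_stable_of_ne S.2 S'.2 (fun h => hne (Subtype.ext h)) f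

end Blocks

/-! ## §3 Prop. 1.5 on `K`-points over the representatives of the isotypy classes -/

section IsotypicInternal

variable {V' : Type u} [AddCommGroup V'] [Module ℚ V'] [Module.Finite ℚ V'] {H' : HodgeStructure V' n}
  {W₀ : Type u} [AddCommGroup W₀] [Module ℚ W₀] [Module.Finite ℚ W₀] {H₀ : HodgeStructure W₀ n}
  {ι : Type} [Fintype ι] [DecidableEq ι] (T : ι → SubHodgeStructure H')
  (hT : DirectSum.IsInternal fun i => (T i).toSubmodule)
  (r : ∀ i, Hom H₀ (T i).toHodgeStructure) (hr : ∀ i, Function.Bijective (r i).toLinearMap)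

include hT hr

/-- **`S(H', ψ')(K) ≃* S(H₀, ψ₀)(K)` for an internal direct sum `V' = ⊕ᵢ Tᵢ` (`ι ≠ ∅`) of sub-Hodge structures all isomorphic
to `H₀`**, any polarizations: transport (§1) along `H₀^{⊕ι} ⥲ H'` (g52-#5), then p34's diagonal `S(H₀)(K) ≃* S(H₀^{⊕ι})(K)`.
[cite: Milne1999LefschetzClasses, §1 p. 644 L21, Prop. 1.5 and Remark 1.6] -/
theorem Polarization.nonempty_lefschetzGroupBaseChange_mulEquiv_of_isInternal_of_forall_bijective [Nonempty ι]
    (ψ' : Polarization H') (ψ₀ : Polarization H₀) :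
    Nonempty (ψ'.lefschetzGroupBaseChange K ≃* ψ₀.lefschetzGroupBaseChange K) := by
  obtain ⟨e, -⟩ := Polarization.exists_lefschetzGroupBaseChange_mulEquiv_of_hom_bijective K _
    (bijective_piDesc_subtypeHom_comp_toLinearMap T hT r hr) (Polarization.pi fun _ : ι => ψ₀) ψ'
  exact ⟨e.symm.trans (Polarization.lefschetzGroupBaseChangePiConstMulEquiv K ι ψ₀).symm⟩

end IsotypicInternal

section Labelled

variable {V : Type u} [AddCommGroup V] [Module ℚ V] [Module.Finite ℚ V] {H : HodgeStructure V n}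
  {ι : Type*} [Fintype ι] [DecidableEq ι] (T : ι → SubHodgeStructure H)
  (hT : DirectSum.IsInternal fun i => (T i).toSubmodule) {κ : Finset ι} {c : ι → κ}
  (hc : ∀ i, ∃ g : Hom (T i).toHodgeStructure (T (c i)).toHodgeStructure, Function.Bijective g.toLinearMap)
  (hκ : ∀ k k' : κ, (∃ g : Hom (T k).toHodgeStructure (T k').toHodgeStructure,
    Function.Bijective g.toLinearMap) → k = k')

include hT hc hκ

/-- **`S(W_k, ψ|_{W_k})(K) ≃* S(T_k, ψ|_{T_k})(K)` for every isotypic block `W_k = ⨆_{c i = k} Tᵢ`** of a labelled irreducible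
decomposition (§3 after re-indexing by `Fin m`). [cite: Milne1999LefschetzClasses, §1 Prop. 1.5 (p. 644) and Remark 1.6] -/
theorem Polarization.nonempty_lefschetzGroupBaseChange_restrict_iSup'_fiber_mulEquiv (ψ : Polarization H) (k : κ) :
    Nonempty (((ψ.restrict (SubHodgeStructure.iSup' fun x : {i // c i = k} => T x.1)).lefschetzGroupBaseChange K) ≃*
      (ψ.restrict (T k)).lefschetzGroupBaseChange K) := by
  classical
  choose r hr using exists_hom_comapSubtype_bijective T hc k
  let eι := (Fintype.equivFin {i // c i = k}).symm
  haveI : Nonempty (Fin (Fintype.card {i // c i = k})) := ⟨Fintype.equivFin _ ⟨k, apply_coe_eq T hc hκ k⟩⟩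
  exact Polarization.nonempty_lefschetzGroupBaseChange_mulEquiv_of_isInternal_of_forall_bijective K
    (fun j => (SubHodgeStructure.iSup' fun x : {i // c i = k} => T x.1).comapSubtype (T (eι j).1))
    (isInternal_comp_equiv'' (isInternal_comapSubtype_iSup'_fiber T hT c k) eι) (fun j => r (eι j))
    (fun j => hr (eι j)) _ _

/-- **MILNE'S PROPOSITION 1.5 ON `K`-POINTS over the representatives: `S(H, ψ)(K) ≃* Π_k S(T_k, ψ|_{T_k})(K)`** for every field
`K ⊇ ℚ` and ANY isotypically-labelled irreducible decomposition of a polarized finite-dimensional `ℚ`-Hodge structure (the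
Hom-orthogonal isotypic blocks `W_k`, §2, then `S(W_k)(K) ≃* S(T_k)(K)` block by block).
[cite: Milne1999LefschetzClasses, §1 Prop. 1.5 (p. 644) and Remark 1.6] -/
theorem Polarization.nonempty_lefschetzGroupBaseChange_mulEquiv_pi_of_labelling (ψ : Polarization H)
    (hirr : ∀ i, (T i).toHodgeStructure.IsIrreducible) :
    Nonempty (ψ.lefschetzGroupBaseChange K ≃* Π k : κ, (ψ.restrict (T k)).lefschetzGroupBaseChange K) := by
  classical
  obtain ⟨e⟩ := ψ.nonempty_lefschetzGroupBaseChange_mulEquiv_pi_of_hom_orthogonal K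
    (fun k : κ => SubHodgeStructure.iSup' fun x : {i // c i = k} => T x.1) (isInternal_iSup'_fiber T hT c)
    fun k l hkl f => hom_iSup'_fiber_eq_zero T hT hc hκ hirr hkl f
  exact ⟨e.trans (MulEquiv.piCongrRight fun k =>
    Classical.choice (ψ.nonempty_lefschetzGroupBaseChange_restrict_iSup'_fiber_mulEquiv K T hT hc hκ k))⟩

end Labelled

/-! ## §4 The canonical block on `K`-points: `S(S, ψ|_S)(K) ≃* S(U, ψ|_U)(K)` -/

section Canonical

variable {V : Type u} [AddCommGroup V] [Module ℚ V] [Module.Finite ℚ V] {H : HodgeStructure V n}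

/-- **`S(S, ψ|_S)(K) ≃* S(U, ψ|_U)(K)` for a CANONICAL BLOCK** (`S` minimal non-zero `E_φ`-stable, `U ⊆ S` irreducible), for every
field `K ⊇ ℚ`. [cite: Milne1999LefschetzClasses, §1 Prop. 1.5 (p. 644) and Remark 1.6] [cite: VoisinHodgeI2002, §7.3.1 Lemma 7.26] -/
theorem Polarization.nonempty_lefschetzGroupBaseChange_restrict_mulEquiv_of_minimal_stable (ψ : Polarization H)
    {S U : SubHodgeStructure H}
    (hS : (∀ a ∈ H.endAlg, ∀ v ∈ S.toSubmodule, a v ∈ S.toSubmodule) ∧ S.toSubmodule ≠ ⊥ ∧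
      ∀ S' : SubHodgeStructure H, (∀ a ∈ H.endAlg, ∀ v ∈ S'.toSubmodule, a v ∈ S'.toSubmodule) →
        S'.toSubmodule ≤ S.toSubmodule → S'.toSubmodule = ⊥ ∨ S'.toSubmodule = S.toSubmodule)
    (hU : U.toHodgeStructure.IsIrreducible) (hUS : U.toSubmodule ≤ S.toSubmodule) :
    Nonempty (((ψ.restrict S).lefschetzGroupBaseChange K) ≃* (ψ.restrict U).lefschetzGroupBaseChange K) := by
  classical
  have hH : H.IsPolarizable := ⟨ψ⟩
  obtain ⟨s, _, κ, c, hint, hirr, hc, hκ⟩ := exists_isInternal_isIrreducible_labelling H hH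
  obtain ⟨k, hk, -⟩ := existsUnique_iSup'_fiber_eq_of_minimal_stable (fun x : s => (x : SubHodgeStructure H)) hint hc hκ
    (fun x => hirr x x.2) hS
  subst hk
  obtain ⟨e₁⟩ := ψ.nonempty_lefschetzGroupBaseChange_restrict_iSup'_fiber_mulEquiv K (fun x : s => (x : SubHodgeStructure H))
    hint hc hκ k
  have hTk : ((k : s) : SubHodgeStructure H).toSubmodule ≤
      (SubHodgeStructure.iSup' fun x : {i : s // c i = k} => ((x.1 : s) : SubHodgeStructure H)).toSubmodule := by
    rw [SubHodgeStructure.iSup'_toSubmodule]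
    exact le_iSup (fun x : {i : s // c i = k} => ((x.1 : s) : SubHodgeStructure H).toSubmodule)
      ⟨k, apply_coe_eq (fun x : s => (x : SubHodgeStructure H)) hc hκ k⟩
  obtain ⟨g, hg⟩ := (exists_hom_bijective_iff_eq_of_minimal_stable hH hS hS (hirr (k : s) (k : s).2) hU hTk hUS).2 rfl
  obtain ⟨e₂, -⟩ := Polarization.exists_lefschetzGroupBaseChange_mulEquiv_of_hom_bijective K g hg (ψ.restrict (k : s))
    (ψ.restrict U)
  exact ⟨e₁.trans e₂⟩

end Canonical

end HodgeStructure

end Literature.AlgebraicGeometry.Motives
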